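import Mathlib
import HarnessLib
import Literature.NumberTheory.LFunctions.HorocycleZeroMode
import Literature.NumberTheory.LFunctions.MoebiusDilatedSums

/-!
# Zero-mode lemma with a power saving: `∑_{c≥1} (φ(c)/c) k(lc) = A/l + O(l^{1-α})`

Support file (everything PROVED, no named facts) for the proof of the named fact
`Literature.NumberTheory.LFunctions.horocycleRate_of_quasiRH` (`HorocycleRH.lean`; Zagier 1981,
§1 p. 279, (Z1)). It sharpens the tree's unconditional zero-mode lemma
`Literature.NumberTheory.LFunctions.HorocycleZeroMode.zeroMode_bound`
(`∑_c (φ(c)/c) k(lc) = (∑_d μ(d)/d²)(∫k)/l + O(1)`) under the power bound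
`|M(t)| ≤ C t^α` (`0 < α < 1`) on the Mertens function, which is what quasi-RH provides
(`MoebiusDilatedSums.exists_mertens_bound_of_quasiRH`):

* `Literature.NumberTheory.LFunctions.HorocycleZeroModeQuasiRH.zeroMode_bound_rpow` — for
  `k : ℝ → ℂ` of class `C³` with `k = 0` on `[R, ∞)` there is `C` with
  `‖∑_{c ≤ N} (φ(c)/c) k(lc) - (∑_d μ(d)/d²)(∫_0^R k)/l‖ ≤ C l^{1-α}` for `0 < l ≤ R/2`, `lN ≥ R`.

Proof. As in the tree (`φ(c)/c = ∑_{d∣c} μ(d)/d`, rows `∑_m k(ldm)` by the trapezoidal rule)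
the difference is `∑_{d ≤ D} (μ(d)/d) E(ld) - (∫k/l) ∑_{d > D} μ(d)/d² - (k(0)/2) ∑_{d ≤ D} μ(d)/d`
with `D ≍ R/l` and the row error `E(a) = ∑_m k(ma) - ∫k/a - k(0)/2 = O(a)`. The three terms are
now `O(l^{1-α})`: the last two by `∑_{d ≤ x} μ(d)/d = O(x^{α-1})` and `∑_{d>D} μ(d)/d² = O(D^{α-2})`
(`MoebiusDilatedSums`), the first by Abel summation against `∑_{d ≤ x} μ(d)/d`, which needs the
row error to be Lipschitz in the step: `E'(a) = ∑ m k'(ma) + ∫k/a² = (a ∑ q(ma) - ∫q)/a²` with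
`q(u) = u k'(u)` (note `∫_0^R q = -∫_0^R k`), and the trapezoidal rule for `q` (`q(0) = 0`) gives
`a ∑ q(ma) - ∫ q = O(a²)`, i.e. `E' = O(1)` (`norm_deriv_rowErr_le`).

## References
* D. Zagier, *Eisenstein series and the Riemann zeta function* (1981), §1 [Zagier1981].
* H. Iwaniec, *Spectral Methods of Automorphic Forms*, 2nd ed. (2002), §3.4 [Iwaniec2002].

## Mathlib / tree search
Tree: `HorocycleZeroMode.sum_totient_div_mul_eq`, `norm_row_sub_le`, `deriv_deriv_eq_zero_of_gt`,
`sum_Ioc_zero_eq_sum_range`, `summable_moebius_div_sq` (`HorocycleZeroMode.lean`);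
`MoebiusDilatedSums.abs_sum_moebius_div_le`, `norm_tsum_moebius_div_sq_tail_le`.
Mathlib: `sum_mul_eq_sub_integral_mul₀` (Abel summation), `integral_rpow`, `HasDerivAt.sum`.
-/

noncomputable section

open Real MeasureTheory Set Filter Finset intervalIntegral
open scoped ArithmeticFunction.Moebius Topology

namespace Literature.NumberTheory.LFunctions

namespace HorocycleZeroModeQuasiRH

open HorocycleZeroMode MoebiusDilatedSums

/-! ### Unpacking `C³` -/

/-- Unpacking `ContDiff ℝ 3`: derivatives up to order three and their continuity. [folklore] -/
theorem hasDerivAt_of_contDiff_three {k : ℝ → ℂ} (hk : ContDiff ℝ 3 k) :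
    (∀ t, HasDerivAt k (deriv k t) t) ∧ (∀ t, HasDerivAt (deriv k) (deriv (deriv k) t) t) ∧
      ContDiff ℝ 2 (deriv k) ∧ Continuous (deriv k) := by
  rw [show (3 : WithTop ℕ∞) = 2 + 1 by norm_num] at hk
  obtain ⟨hd, -, hk2⟩ := contDiff_succ_iff_deriv.mp hk
  obtain ⟨h1, -, -, -⟩ := hasDerivAt_of_contDiff_two hk2
  exact ⟨fun t => (hd t).hasDerivAt, h1, hk2, hk2.continuous⟩

/-! ### The row sum as a function of the step, and its derivative -/

/-- The row sum `T(a) = ∑_{m=0}^{M} k(ma)` has derivative `∑ m k'(ma)` in the step `a`. [folklore] -/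
theorem hasDerivAt_rowSum {k : ℝ → ℂ} (hk : ∀ t, HasDerivAt k (deriv k t) t) (M : ℕ) (a : ℝ) :
    HasDerivAt (fun a : ℝ => ∑ m ∈ Finset.range (M + 1), k (m * a))
      (∑ m ∈ Finset.range (M + 1), (m : ℂ) * deriv k (m * a)) a := by
  have h : ∀ m ∈ Finset.range (M + 1), HasDerivAt (fun a : ℝ => k (m * a))
      ((m : ℂ) * deriv k (m * a)) a := fun m _ => by
    have h1 := (hk (m * a)).scomp a (hasDerivAt_const_mul (m : ℝ) : HasDerivAt
      (fun a : ℝ => (m : ℝ) * a) (m : ℝ) a)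
    simp only [Function.comp_def, Complex.real_smul, Complex.ofReal_natCast] at h1
    convert h1 using 1
  exact HasDerivAt.fun_sum h

/-- `∫_0^{R'} u k'(u) du = -∫_0^{R'} k` when `k(R') = 0`. [folklore] -/
theorem integral_mul_deriv_eq_neg {k : ℝ → ℂ} (hk : ∀ t, HasDerivAt k (deriv k t) t)
    (hkc : Continuous (deriv k)) {R' : ℝ} (hkR' : k R' = 0) :
    ∫ u in (0 : ℝ)..R', (u : ℂ) * deriv k u = -∫ u in (0 : ℝ)..R', k u := by
  have hu : ∀ u ∈ Set.uIcc (0 : ℝ) R', HasDerivAt (fun u : ℝ => (u : ℂ)) 1 u := fun u _ => by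
    simpa using (hasDerivAt_id u).ofReal_comp
  have h := intervalIntegral.integral_mul_deriv_eq_deriv_mul (a := 0) (b := R')
    (u := fun u : ℝ => (u : ℂ)) (u' := fun _ => (1 : ℂ)) (v := k) (v' := deriv k)
    hu (fun u _ => hk u) intervalIntegrable_const (hkc.intervalIntegrable _ _)
  rw [h, hkR']
  simp

/-! ### The main estimate -/

-- the main proof is long (three estimates assembled in one declaration); the raised limit is
-- deterministic-timeout insurance only
set_option maxHeartbeats 800000 in
/-- **Zero-mode lemma with power saving.** Let `k : ℝ → ℂ` be `C³` with `k = 0` on `[R, ∞)`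
(`R > 0`), and assume `|M(t)| ≤ C_M t^α` for `t ≥ 1` with `0 < α < 1`. Then there is `C` with
`‖∑_{1 ≤ c ≤ N} (φ(c)/c) k(lc) - (∑_d μ(d)/d²)(∫_0^R k)/l‖ ≤ C l^{1-α}` for all `0 < l ≤ R/2`
and all `N ≥ R/l` (the sum does not depend on such `N`). [folklore] -/
theorem zeroMode_bound_rpow {k : ℝ → ℂ} (hk : ContDiff ℝ 3 k) {R : ℝ} (hR : 0 < R)
    (hkR : ∀ s, R ≤ s → k s = 0) {C_M α : ℝ} (hCM : 0 ≤ C_M) (hα0 : 0 < α) (hα1 : α < 1)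
    (hM : ∀ t : ℝ, 1 ≤ t → |∑ n ∈ Finset.Icc 0 ⌊t⌋₊, (μ n : ℝ)| ≤ C_M * t ^ α) :
    ∃ C : ℝ, ∀ l : ℝ, 0 < l → l ≤ R / 2 → ∀ N : ℕ, R ≤ l * N →
      ‖∑ c ∈ Finset.Ioc 0 N, ((Nat.totient c : ℂ) / c) * k (l * c) -
        (∑' d : ℕ, (μ d : ℂ) / (d : ℂ) ^ 2) * (∫ s in (0 : ℝ)..R, k s) / l‖ ≤ C * l ^ (1 - α) := by
  -- derivatives of `k`
  have hk2 : ContDiff ℝ 2 k := hk.of_le (by norm_num)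
  obtain ⟨hd0, hd1, hk1C2, hc1⟩ := hasDerivAt_of_contDiff_three hk
  obtain ⟨-, -, -, hc2⟩ := hasDerivAt_of_contDiff_two hk2
  -- `q(u) = u k'(u)`, a `C²` function vanishing on `[R+1, ∞)`
  set R' : ℝ := R + 1 with hR'
  set q : ℝ → ℂ := fun u => (u : ℂ) * deriv k u with hq
  have hqC2 : ContDiff ℝ 2 q := (Complex.ofRealCLM.contDiff.of_le le_top).mul hk1C2
  have hqR' : ∀ s, R' ≤ s → q s = 0 := fun s hs => by
    rw [hq]; dsimp only
    rw [(deriv_deriv_eq_zero_of_gt hkR (by linarith : R < s)).1, mul_zero]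
  have hkR'0 : k R' = 0 := hkR R' (by linarith)
  -- constants
  set I : ℂ := ∫ s in (0 : ℝ)..R, k s with hI
  set K₂ : ℝ := ∫ s in (0 : ℝ)..R, ‖deriv (deriv k) s‖ with hK₂
  set Kq : ℝ := ∫ s in (0 : ℝ)..R', ‖deriv (deriv q) s‖ with hKq
  set S : ℂ := ∑' d : ℕ, (μ d : ℂ) / (d : ℂ) ^ 2 with hS
  set Cm : ℝ := C_M * (1 + 1 / (1 - α)) with hCm
  have hK₂0 : 0 ≤ K₂ := intervalIntegral.integral_nonneg hR.le fun s _ => norm_nonneg _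
  have hKq0 : 0 ≤ Kq := intervalIntegral.integral_nonneg (by linarith) fun s _ => norm_nonneg _
  have hCm0 : 0 ≤ Cm := by
    have : 0 ≤ 1 / (1 - α) := div_nonneg zero_le_one (by linarith)
    positivity
  -- `∫_0^{R'} q = -I` (`k = 0` on `[R, R']`)
  have hIq : ∫ s in (0 : ℝ)..R', q s = -I := by
    rw [hq, integral_mul_deriv_eq_neg hd0 hc1 hkR'0, hI]
    congr 1
    rw [← intervalIntegral.integral_add_adjacent_intervals (b := R)
      (hk.continuous.intervalIntegrable _ _) (hk.continuous.intervalIntegrable _ _)]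
    have : ∫ s in R..R', k s = 0 := by
      rw [intervalIntegral.integral_congr (g := fun _ => (0 : ℂ)) fun s hs => ?_]
      · simp
      · rw [Set.uIcc_of_le (by linarith)] at hs; exact hkR s hs.1
    rw [this, add_zero]
  -- the bound on `∑ μ(d)/d`
  have hm : ∀ x : ℝ, 1 ≤ x → |∑ n ∈ Finset.Icc 1 ⌊x⌋₊, (μ n : ℝ) / n| ≤ Cm * x ^ (α - 1) :=
    fun x hx => abs_sum_moebius_div_le hα1 hM hx
  -- THE CONSTANT
  refine ⟨(R / 8) * K₂ * Cm * (2 / R) ^ (1 - α) + (Kq * Cm / (8 * α)) * R ^ α +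
    4 * C_M * ‖I‖ * (2 / R) ^ (2 - α) + (‖k 0‖ / 2) * Cm * (2 / R) ^ (1 - α),
    fun l hl hlR N hN => ?_⟩
  -- Möbius rearrangement and the range of rows
  rw [sum_totient_div_mul_eq]
  set D₀ : ℕ := ⌊R / l⌋₊ with hD₀
  set D : ℕ := min N D₀ with hD
  have hDN : D ≤ N := min_le_left _ _
  have hDl : (D : ℝ) * l ≤ R := by
    have h1 : (D : ℝ) ≤ D₀ := by exact_mod_cast min_le_right _ _
    have h2 : (D₀ : ℝ) ≤ R / l := Nat.floor_le (by positivity)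
    calc (D : ℝ) * l ≤ (R / l) * l := by gcongr; exact h1.trans h2
      _ = R := by field_simp
  have hDl' : R < (D + 1 : ℝ) * l := by
    rcases le_or_gt N D₀ with h | h
    · have : D = N := min_eq_left h
      rw [this]
      nlinarith
    · have : D = D₀ := min_eq_right h.le
      rw [this, hD₀]
      calc R = (R / l) * l := by field_simp
        _ < (⌊R / l⌋₊ + 1 : ℝ) * l := by gcongr; exact Nat.lt_floor_add_one (R / l)
  have hDge : R / (2 * l) ≤ D := by
    rw [div_le_iff₀ (by positivity)]
    nlinarith
  have hD1 : 1 ≤ D := by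
    have : (1 : ℝ) ≤ D := le_trans (by rw [le_div_iff₀ (by positivity)]; linarith) hDge
    exact_mod_cast this
  have hD0 : (0 : ℝ) < D := by exact_mod_cast hD1
  have hDRl : (D : ℝ) ≤ R / l := by rw [le_div_iff₀ hl]; exact hDl
  -- rows beyond `D` vanish
  set row : ℕ → ℂ := fun d => ∑ m ∈ Finset.Ioc 0 (N / d), k (l * (d * m : ℕ)) with hrow
  have hvan : ∀ d ∈ Finset.Ioc 0 N, d ∉ Finset.Ioc 0 D → ((μ d : ℂ) / d) * row d = 0 := by
    intro d hd hdD
    rw [Finset.mem_Ioc] at hd hdD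
    have hDd : D < d := by
      by_contra h; exact hdD ⟨hd.1, not_lt.mp h⟩
    have hd' : D₀ < d := by
      rcases le_or_gt N D₀ with h | h
      · exact absurd (lt_of_lt_of_le (min_eq_left h ▸ hDd) hd.2) (lt_irrefl _)
      · rwa [show D = D₀ from min_eq_right h.le] at hDd
    have hld : R < l * d := by
      have h1 : R / l < d := by
        calc R / l < (⌊R / l⌋₊ : ℝ) + 1 := Nat.lt_floor_add_one _
          _ ≤ d := by exact_mod_cast hd'
      rwa [div_lt_iff₀ hl, mul_comm] at h1
    have : row d = 0 := by
      refine Finset.sum_eq_zero fun m hm => hkR _ ?_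
      rw [Finset.mem_Ioc] at hm
      have : (d : ℝ) ≤ (d * m : ℕ) := by exact_mod_cast Nat.le_mul_of_pos_right d hm.1
      nlinarith
    rw [this, mul_zero]
  rw [← Finset.sum_subset (Finset.Ioc_subset_Ioc_right hDN) hvan]
  -- the row error as a function of the step `a`, with a fixed (large) number of terms
  set M₀ : ℕ := N + ⌈1 / l⌉₊ + 1 with hM₀
  have hM₀l : R' ≤ M₀ * l := by
    have h1 : (1 / l : ℝ) ≤ ⌈1 / l⌉₊ := Nat.le_ceil _
    have h2 : (M₀ : ℝ) * l = l * N + (⌈1 / l⌉₊ : ℝ) * l + l := by rw [hM₀]; push_cast; ring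
    rw [h2]
    have h3 : (1 : ℝ) ≤ (⌈1 / l⌉₊ : ℝ) * l := by
      calc (1 : ℝ) = (1 / l) * l := by field_simp
        _ ≤ (⌈1 / l⌉₊ : ℝ) * l := by gcongr
    rw [hR']; linarith
  set E : ℝ → ℂ := fun a => ∑ m ∈ Finset.range (M₀ + 1), k (m * a) - I / a - k 0 / 2 with hE
  set E' : ℝ → ℂ := fun a => ∑ m ∈ Finset.range (M₀ + 1), (m : ℂ) * deriv k (m * a) + I / a ^ 2
    with hE'
  -- (E1) size of the row error
  have hRR' : R ≤ R' := by rw [hR']; linarith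
  have hE1 : ∀ a : ℝ, 0 < a → l ≤ a → ‖E a‖ ≤ (a / 8) * K₂ := fun a ha hla => by
    have hMa : R ≤ (M₀ : ℝ) * a := by
      have := mul_le_mul_of_nonneg_left hla (Nat.cast_nonneg M₀)
      linarith
    have := norm_row_sub_le hk2 hkR ha hMa
    rw [hE]; simpa [hK₂] using this
  -- (E2) derivative of the row error in the step
  have hE2 : ∀ a : ℝ, 0 < a → HasDerivAt E (E' a) a := fun a ha => by
    have h1 := hasDerivAt_rowSum hd0 M₀ a
    have h2 : HasDerivAt (fun a : ℝ => I / a) (-(I / a ^ 2)) a := by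
      have h := ((hasDerivAt_inv ha.ne').ofReal_comp).const_mul I
      refine (h.congr_of_eventuallyEq ?_).congr_deriv ?_
      · exact Eventually.of_forall fun x => by simp [div_eq_mul_inv]
      · push_cast; field_simp
    have h3 := (h1.sub h2).sub_const (k 0 / 2)
    rw [hE, hE']
    exact h3.congr_deriv (by ring)
  -- (E3) the derivative is bounded: `‖E'(a)‖ ≤ Kq/8` for `a ≥ l`
  have hE3 : ∀ a : ℝ, 0 < a → l ≤ a → ‖E' a‖ ≤ Kq / 8 := fun a ha hla => by
    have hMa : R' ≤ (M₀ : ℝ) * a := by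
      have := mul_le_mul_of_nonneg_left hla (Nat.cast_nonneg M₀)
      linarith
    have hrow := norm_row_sub_le hqC2 hqR' ha hMa
    rw [hIq] at hrow
    have hq0 : q 0 = 0 := by rw [hq]; simp
    rw [hq0, zero_div, sub_zero] at hrow
    -- `a E'(a) = ∑ q(ma) + I/a`
    have hkey : (a : ℂ) * E' a = ∑ m ∈ Finset.range (M₀ + 1), q (m * a) - (-I) / a := by
      rw [hE', hq]; dsimp only
      rw [neg_div, sub_neg_eq_add, mul_add, Finset.mul_sum]
      have ha' : (a : ℂ) ≠ 0 := by exact_mod_cast ha.ne'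
      congr 1
      · refine Finset.sum_congr rfl fun m _ => ?_
        push_cast; ring
      · field_simp
    have hn : ‖(a : ℂ) * E' a‖ ≤ (a / 8) * Kq := by rw [hkey]; simpa [hKq] using hrow
    rw [norm_mul, Complex.norm_real, Real.norm_of_nonneg ha.le] at hn
    rw [le_div_iff₀ (by norm_num : (0:ℝ) < 8)]
    nlinarith
  -- rows in terms of `E`
  have hrowE : ∀ d ∈ Finset.Ioc 0 D, row d = E (l * d) + I / (l * d) - k 0 / 2 := by
    intro d hd
    rw [Finset.mem_Ioc] at hd
    have hd0 : 0 < d := hd.1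
    -- `∑_{m ∈ range (M₀+1)} k(m (l d)) = k 0 + row d`
    have hsplit : ∑ m ∈ Finset.range (M₀ + 1), k (m * (l * d)) = k 0 + row d := by
      rw [Finset.sum_range_succ', Nat.cast_zero, zero_mul, add_comm]
      congr 1
      rw [hrow]; dsimp only
      rw [sum_Ioc_zero_eq_sum_range]
      -- extend the range: terms `m > N/d` vanish
      have hsub : Finset.range (N / d) ⊆ Finset.range M₀ := Finset.range_subset_range.mpr (by
        rw [hM₀]; have := Nat.div_le_self N d; omega)
      rw [← Finset.sum_subset hsub]
      · refine Finset.sum_congr rfl fun i _ => ?_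
        congr 1; push_cast; ring
      · intro m hm hmN
        rw [Finset.mem_range, not_lt] at hmN
        apply hkR
        have h1 : (N : ℝ) < (m + 1 : ℕ) * d := by
          have : N < (N / d + 1) * d := by
            rw [mul_comm]; exact Nat.lt_mul_div_succ N hd0
          calc (N : ℝ) < ((N / d + 1) * d : ℕ) := by exact_mod_cast this
            _ ≤ (m + 1 : ℕ) * d := by
                rw [← Nat.cast_mul]; exact_mod_cast Nat.mul_le_mul_right d (by omega)
        have h2 : ((m + 1 : ℕ) : ℝ) * (l * d) = l * ((m + 1 : ℕ) * d) := by ring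
        rw [h2]
        nlinarith
    rw [hE]; dsimp only
    rw [hsplit]; push_cast; ring
  -- algebra: split the difference into three terms
  have hl' : (l : ℂ) ≠ 0 := by exact_mod_cast hl.ne'
  have halg : ∑ d ∈ Finset.Ioc 0 D, ((μ d : ℂ) / d) * row d - S * I / l =
      ∑ d ∈ Finset.Ioc 0 D, ((μ d : ℂ) / d) * E (l * d) -
        (I / l) * (S - ∑ d ∈ Finset.Ioc 0 D, (μ d : ℂ) / (d : ℂ) ^ 2) -
        (k 0 / 2) * ∑ d ∈ Finset.Ioc 0 D, (μ d : ℂ) / d := by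
    have e1 : ∀ d ∈ Finset.Ioc 0 D, ((μ d : ℂ) / d) * row d =
        ((μ d : ℂ) / d) * E (l * d) + (I / l) * ((μ d : ℂ) / (d : ℂ) ^ 2) -
          (k 0 / 2) * ((μ d : ℂ) / d) := by
      intro d hd
      have hd0 : (d : ℂ) ≠ 0 := by exact_mod_cast (Finset.mem_Ioc.1 hd).1.ne'
      rw [hrowE d hd]
      field_simp
    rw [Finset.sum_congr rfl e1, Finset.sum_sub_distrib, Finset.sum_add_distrib,
      ← Finset.mul_sum, ← Finset.mul_sum]
    ring
  rw [halg]
  -- rpow bookkeeping: `D^{α-1} ≤ (2/R)^{1-α} l^{1-α}`, `D^{α-2} ≤ (2/R)^{2-α} l^{2-α}`,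
  -- `l D^α ≤ R^α l^{1-α}`
  have h2l : 0 < R / (2 * l) := by positivity
  have hpow1 : (D : ℝ) ^ (α - 1) ≤ (2 / R) ^ (1 - α) * l ^ (1 - α) := by
    calc (D : ℝ) ^ (α - 1) ≤ (R / (2 * l)) ^ (α - 1) :=
          Real.rpow_le_rpow_of_nonpos h2l hDge (by linarith)
      _ = (2 / R) ^ (1 - α) * l ^ (1 - α) := by
          rw [← Real.mul_rpow (by positivity) hl.le, show (1 - α) = -(α - 1) by ring,
            Real.rpow_neg (by positivity), ← Real.inv_rpow (by positivity)]
          congr 1; field_simp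
  have hpow2 : (D : ℝ) ^ (α - 2) ≤ (2 / R) ^ (2 - α) * l ^ (2 - α) := by
    calc (D : ℝ) ^ (α - 2) ≤ (R / (2 * l)) ^ (α - 2) :=
          Real.rpow_le_rpow_of_nonpos h2l hDge (by linarith)
      _ = (2 / R) ^ (2 - α) * l ^ (2 - α) := by
          rw [← Real.mul_rpow (by positivity) hl.le, show (2 - α) = -(α - 2) by ring,
            Real.rpow_neg (by positivity), ← Real.inv_rpow (by positivity)]
          congr 1; field_simp
  have hpow3 : l * (D : ℝ) ^ α ≤ R ^ α * l ^ (1 - α) := by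
    calc l * (D : ℝ) ^ α ≤ l * (R / l) ^ α := by gcongr
      _ = R ^ α * l ^ (1 - α) := by
          rw [Real.div_rpow hR.le hl.le, Real.rpow_sub hl, Real.rpow_one]
          field_simp
  -- (b1) Abel summation for `∑ (μ(d)/d) E(ld)` (`MoebiusDilatedSums.norm_sum_moebius_div_mul_le`)
  have b1 : ‖∑ d ∈ Finset.Ioc 0 D, ((μ d : ℂ) / d) * E (l * d)‖ ≤
      (R / 8) * K₂ * (Cm * (D : ℝ) ^ (α - 1)) + ((l * Kq / 8) * Cm / α) * (D : ℝ) ^ α := by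
    have hfd : ∀ t : ℝ, 0 < t → HasDerivAt (fun t : ℝ => E (l * t)) ((l : ℂ) * E' (l * t)) t :=
      fun t ht => by
      have h1 := (hE2 (l * t) (by positivity)).scomp t
        (hasDerivAt_const_mul l : HasDerivAt (fun t : ℝ => l * t) l t)
      simp only [Function.comp_def, Complex.real_smul] at h1
      exact h1
    have hE'c : ContinuousOn E' (Set.Ioi 0) := by
      rw [hE']
      refine ContinuousOn.add (Continuous.continuousOn ?_) ?_
      · exact continuous_finsetSum _ fun m _ =>
          continuous_const.mul (hc1.comp (continuous_const.mul continuous_id))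
      · refine continuousOn_const.div (Complex.continuous_ofReal.pow 2).continuousOn
          fun a ha => ?_
        exact pow_ne_zero 2 (Complex.ofReal_ne_zero.mpr (ne_of_gt (Set.mem_Ioi.mp ha)))
    have hf'c : ContinuousOn (fun t : ℝ => (l : ℂ) * E' (l * t)) (Set.Icc (1 : ℝ) D) := by
      refine continuousOn_const.mul (hE'c.comp (continuous_const.mul continuous_id).continuousOn
        fun t ht => ?_)
      exact Set.mem_Ioi.mpr (mul_pos hl (by linarith [ht.1]))
    have hB₀ : ‖(fun t : ℝ => E (l * t)) D‖ ≤ (R / 8) * K₂ := by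
      dsimp only
      refine (hE1 (l * D) (by positivity)
        (le_mul_of_one_le_right hl.le (by exact_mod_cast hD1))).trans ?_
      have : l * (D : ℝ) ≤ R := by rw [mul_comm]; exact hDl
      gcongr
    have hB₁ : ∀ t ∈ Set.Icc (1 : ℝ) D, ‖(l : ℂ) * E' (l * t)‖ ≤ l * Kq / 8 := fun t ht => by
      rw [norm_mul, Complex.norm_real, Real.norm_of_nonneg hl.le]
      have h1 : ‖E' (l * t)‖ ≤ Kq / 8 := hE3 (l * t) (by nlinarith [ht.1])
        (le_mul_of_one_le_right hl.le ht.1)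
      calc l * ‖E' (l * t)‖ ≤ l * (Kq / 8) := by gcongr
        _ = l * Kq / 8 := by ring
    exact norm_sum_moebius_div_mul_le (f := fun t : ℝ => E (l * t)) hCm0 hα0 hm hD1
      (fun t ht => hfd t (by linarith [ht.1])) hf'c hB₀ (by positivity) hB₁
  -- (b2) the tail of `∑ μ(d)/d²`
  have b2 : ‖(I / l) * (S - ∑ d ∈ Finset.Ioc 0 D, (μ d : ℂ) / (d : ℂ) ^ 2)‖ ≤
      (‖I‖ / l) * (4 * C_M * (D : ℝ) ^ (α - 2)) := by
    rw [norm_mul, norm_div, Complex.norm_real, Real.norm_of_nonneg hl.le]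
    gcongr
    exact norm_tsum_moebius_div_sq_tail_le hCM hα1 hM hD1
  -- (b3) `∑_{d ≤ D} μ(d)/d`
  have b3 : ‖(k 0 / 2) * ∑ d ∈ Finset.Ioc 0 D, (μ d : ℂ) / d‖ ≤
      (‖k 0‖ / 2) * (Cm * (D : ℝ) ^ (α - 1)) := by
    rw [norm_mul, norm_div]
    norm_num
    gcongr
    have e : ∑ d ∈ Finset.Ioc 0 D, (μ d : ℂ) / d =
        ((∑ d ∈ Finset.Icc 1 D, (μ d : ℝ) / d : ℝ) : ℂ) := by
      rw [show Finset.Ioc 0 D = Finset.Icc 1 D by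
        ext; simp only [Finset.mem_Ioc, Finset.mem_Icc]; omega]
      push_cast; rfl
    rw [e, Complex.norm_real, Real.norm_eq_abs]
    have := hm D (by exact_mod_cast hD1)
    rwa [Nat.floor_natCast] at this
  -- the three terms against `l^{1-α}`
  have b1' : ‖∑ d ∈ Finset.Ioc 0 D, ((μ d : ℂ) / d) * E (l * d)‖ ≤
      (R / 8) * K₂ * Cm * ((2 / R) ^ (1 - α) * l ^ (1 - α)) +
        (Kq * Cm / (8 * α)) * (R ^ α * l ^ (1 - α)) := by
    refine b1.trans ?_
    calc (R / 8) * K₂ * (Cm * (D : ℝ) ^ (α - 1)) + ((l * Kq / 8) * Cm / α) * (D : ℝ) ^ α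
        = (R / 8) * K₂ * Cm * (D : ℝ) ^ (α - 1) + (Kq * Cm / (8 * α)) * (l * (D : ℝ) ^ α) := by
          ring
      _ ≤ _ := add_le_add (mul_le_mul_of_nonneg_left hpow1 (by positivity))
          (mul_le_mul_of_nonneg_left hpow3 (by positivity))
  have b2' : ‖(I / l) * (S - ∑ d ∈ Finset.Ioc 0 D, (μ d : ℂ) / (d : ℂ) ^ 2)‖ ≤
      4 * C_M * ‖I‖ * (2 / R) ^ (2 - α) * l ^ (1 - α) := by
    refine b2.trans ?_
    calc (‖I‖ / l) * (4 * C_M * (D : ℝ) ^ (α - 2))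
        ≤ (‖I‖ / l) * (4 * C_M * ((2 / R) ^ (2 - α) * l ^ (2 - α))) :=
          mul_le_mul_of_nonneg_left (mul_le_mul_of_nonneg_left hpow2 (by positivity))
            (by positivity)
      _ = 4 * C_M * ‖I‖ * (2 / R) ^ (2 - α) * l ^ (1 - α) := by
          have e : l ^ (2 - α) = l * l ^ (1 - α) := by
            rw [show (2 - α) = 1 + (1 - α) by ring, Real.rpow_add hl, Real.rpow_one]
          rw [e]
          field_simp
  have b3' : ‖(k 0 / 2) * ∑ d ∈ Finset.Ioc 0 D, (μ d : ℂ) / d‖ ≤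
      (‖k 0‖ / 2) * Cm * (2 / R) ^ (1 - α) * l ^ (1 - α) := by
    refine b3.trans ?_
    calc (‖k 0‖ / 2) * (Cm * (D : ℝ) ^ (α - 1))
        ≤ (‖k 0‖ / 2) * (Cm * ((2 / R) ^ (1 - α) * l ^ (1 - α))) :=
          mul_le_mul_of_nonneg_left (mul_le_mul_of_nonneg_left hpow1 hCm0) (by positivity)
      _ = (‖k 0‖ / 2) * Cm * (2 / R) ^ (1 - α) * l ^ (1 - α) := by ring
  -- assemble
  calc ‖∑ d ∈ Finset.Ioc 0 D, ((μ d : ℂ) / d) * E (l * d) -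
        (I / l) * (S - ∑ d ∈ Finset.Ioc 0 D, (μ d : ℂ) / (d : ℂ) ^ 2) -
        (k 0 / 2) * ∑ d ∈ Finset.Ioc 0 D, (μ d : ℂ) / d‖
      ≤ ‖∑ d ∈ Finset.Ioc 0 D, ((μ d : ℂ) / d) * E (l * d)‖ +
        ‖(I / l) * (S - ∑ d ∈ Finset.Ioc 0 D, (μ d : ℂ) / (d : ℂ) ^ 2)‖ +
        ‖(k 0 / 2) * ∑ d ∈ Finset.Ioc 0 D, (μ d : ℂ) / d‖ :=
        norm_sub_le_of_le (norm_sub_le _ _) le_rfl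
    _ ≤ ((R / 8) * K₂ * Cm * ((2 / R) ^ (1 - α) * l ^ (1 - α)) +
          (Kq * Cm / (8 * α)) * (R ^ α * l ^ (1 - α))) +
        4 * C_M * ‖I‖ * (2 / R) ^ (2 - α) * l ^ (1 - α) +
        (‖k 0‖ / 2) * Cm * (2 / R) ^ (1 - α) * l ^ (1 - α) :=
        add_le_add (add_le_add b1' b2') b3'
    _ = ((R / 8) * K₂ * Cm * (2 / R) ^ (1 - α) + (Kq * Cm / (8 * α)) * R ^ α +
          4 * C_M * ‖I‖ * (2 / R) ^ (2 - α) + (‖k 0‖ / 2) * Cm * (2 / R) ^ (1 - α)) *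
          l ^ (1 - α) := by ring

end HorocycleZeroModeQuasiRH

end Literature.NumberTheory.LFunctions

end
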